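/-
Copyright (c) 2026 the pub-hodgecm-mathlib formalisation cell (harness21).  Prover seat hodgecm-mathlib-LH4-p08 (g4), Track A «(D-RAM) FOUR-FRAME», unit U2H, the census leaf
(ρ2b′-X) `stub_U2H_fixedPointCensus_typeTwo_unit0` — dealer LH4-plan (g12) WORD #16 hand T5a «TORIC LEVEL CENSUS, K-UNRAMIFIED» (payer of record LH4-p14 (g3) RHO2BX-ORDER v1,
organs O-W ∕ O-Cone): the bridge from the order lattice `x₀·𝒪_j` of ★ T4 to the NORM-ONE TORUS of the third field.  2026-09-04.
-/
import Literature.NumberTheory.LocalFields.QuadraticOrderNormLine   -- ★ p857156 (LH4-p12 (g4) F3: `y − ρy = (k + ρk)·cδ`, `map_mul_map_self`, `mul_line_mem_order_iff`) → ★ p857067 (T4c) → ★ p857040 → ★ p857021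
import HarnessLib

/-!
# The dual generator `y = h·x₀Θ(x₀)·c(α − ρα)` of an order lattice: its `ρ`-TWIST lives in the third field — `ρy∕y = −(ρh∕h)·(ρN∕N)`, `N = x₀Θx₀` — and the
# INTEGRAL ∧ GRAM-PRIMITIVE dichotomy `(|y| = 1 ∧ |y − ρy| ≤ |c(α − ρα)|) ∨ (|y| ≤ 1 ∧ |y − ρy| = |c(α − ρα)|)` in the frame where `ϖ_E` is a uniformiser of `M`
(Jacobowitz 1962 §4 (scales of hermitian lattices); Serre, *Local Fields* Ch. V §3 (the filtration of the norm-one group); Flicker 1998 p. 84 (Mars' orders))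

Topic `NumberTheory/LocalFields`; namespace `Literature.NumberTheory.LocalFields.QuadraticOrder` (= ★ T4 parts I–III `QuadraticOrderIntegralBasis` p857021, `QuadraticOrderLattices`
p857040, `QuadraticOrderHermitianDual` p857067).  THEOREMS ONLY (no definition, no instance, no notation, no named fact, no `sorry`); kernel lane `--supports
stmt-HodgeConjecture-24833` (count-neutral).  Cell `pub/hodgecm-mathlib` (D-0151), crux H413, Track A «(D-RAM) FOUR-FRAME», unit U2H: in the toric ∕ order reduction of the WILD
type-(2) fixed-point census (ρ2b′-X) (LH4-p12 (g3) PAYER-PLAN-rho2bX v2, LH4-p14 (g3) RHO2BX-ORDER v1 organs O-W ∕ O-Cone, F0P3a-p01 (g32) E1 v0 laws (L1)–(L3)) the per-level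
count `n_s(j,a)` of integral, Gram-primitive `λ`-stable plane lattices `x₀·𝒪_j` is a FIBRE COUNT on the norm-one torus of the third quadratic field `K♮ = M^Θ` (this seat's
statement sheet `T5a-LEVEL-TABLE.v1` c9187e8c, mechanism (M2)(M3)).  THIS FILE types the two interface-free steps of that mechanism in ★ T4's one-field currency, ON TOP OF LH4-p12 (g4)'s
★ F3 `QuadraticOrderNormLine` (which carries the TRACE form `y − ρy = (k + ρk)·cδ` of the twist and the separate integral ∕ scaled tests (P); here: the TORUS form
`y·(1 + ηt)` of the same twist — `k + ρk = k·(1 + ρk∕k)` — the EXACT level↔depth dichotomy combining (P) with the scaled test, and the off-diagonal depth max-lemma;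
`N_Θ(x) ∈ K♮` is ★ F3 `map_mul_map_self`, not restated):

* (M3) THE `ρ`-TWIST OF `y` IS A TORUS ELEMENT OF `K♮`: `ρ y = −ρh·ρN·c(α − ρα)` (`ρc = c`, `ρ(α − ρα) = −(α − ρα)`), hence **`y − ρy = y·(1 + (ρh∕h)·(ρN∕N))`** and
  **`|y − ρy| = |y|·|1 + (ρh∕h)·(ρN∕N)|`** with `N = x₀Θ(x₀)` `Θ`-FIXED (`ΘΘ = id`) and `ρN = N_Θ(ρx₀)` (`Θρ = ρΘ`): the `ρ`-depth of `y` is the valuation of `1 + η·t`, `η = ρh∕h`,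
  `t = ρN∕N`, two norm-one elements of `K♮ ∕ F`; `t` is blind to `ρ`-fixed rescaling of `x₀` (§1–§2).
* (M2) THE INTEGRAL ∧ GRAM-PRIMITIVE DICHOTOMY: for `ϖ` a `ρ`-fixed UNIFORMISER of the one field (`|ϖ| = exp(−1)`: the frame where `M ∕ E` is UNRAMIFIED — T5a; in T5c `|ϖ_E| = exp(−2)`
  and the dichotomy is different) and any bound `r ≠ 0`: `(|y| ≤ 1 ∧ |y − ρy| ≤ r) ∧ ¬(|y∕ϖ| ≤ 1 ∧ |y∕ϖ − ρ(y∕ϖ)| ≤ r)` **`⟺ (|y| = 1 ∧ |y − ρy| ≤ r) ∨ (|y| ≤ 1 ∧ |y − ρy| = r)`**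
  (§3; discreteness of `ℤᵐ⁰`: `x·exp 1 > r ≥ x ⟹ x = r`) — with ★ T4c `forall_mem_forall_mem_v_herm_le_one_iff` (integral `⟺ y` in the order) and `forall_mem_exists_dual_eq_mul_iff`
  at `e = ϖ` (NOT Gram-primitive `⟺ y∕ϖ` in the order) this is E1 (L2)'s «`a(ω) = j − c(ω)`, `a = 0` when `c ≥ j`»: an integral primitive lattice of level `a = v(y) ≥ 1` has
  `ρ`-depth EXACTLY `j − a`, one of level `0` has `ρ`-depth `≥ j`.
HONEST LABEL: HC_CM is proved only modulo the 7 printed citations (2 remaining named inputs: hLiu418 = stmt-HodgeConjecture-24832, h413 = stmt-HodgeConjecture-24833) until rung 0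
closes; unconditional local algebra, count-neutral (two steps of organ O-Cone∕T5a of the (ρ2b′-X) payer plan; the torus LAW itself is ★ `WildQuadraticDatumNormOneQuotient` §2 +
★ `RamifiedQuadraticOrderUnitIndexWild` (Mars' index), the uniformity (M4) and the count head are separate files).

## References
* [Jacobowitz1962] R. Jacobowitz, *Hermitian forms over local fields*, Amer. J. Math. 84 (1962): §4 (hermitian lattices, duals `L^#`, scales and norms; modular lattices).
* [Serre1979] J.-P. Serre, *Local Fields*, GTM 67 (1979): Ch. V §3 (the filtration `U^{(n)}` and norm-one elements of a ramified quadratic extension), Ch. III §6 Prop. 11 (Euler).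
* [Flicker1998UnitaryFL] Y. Z. Flicker, *Elementary proof of the fundamental lemma for a unitary group*, Canad. J. Math. 50 (1998): p. 84 REMARK (Mars: the orders `R + π^j R_E` and
  their lattices `z·R_E(j)`).
-/

set_option autoImplicit false

open WithZero

namespace Literature.NumberTheory.LocalFields.QuadraticOrder

variable {K : Type*} [Field K]

/-! ## §1 The `ρ`-twist of the dual generator `y = h·x₀Θ(x₀)·c(α − ρα)` (field algebra, no valuation) -/

section Algebra

variable {ρ Θ : K →+* K} {α : K}

/-- `ρ(N_Θ x) = N_Θ(ρ x)` (`Θρ = ρΘ`): the `ρ`-conjugate of a hermitian norm is again a hermitian norm. [cite: Jacobowitz1962, §4] -/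
theorem map_mul_theta_self (hΘρ : ∀ x, Θ (ρ x) = ρ (Θ x)) (x : K) : ρ (x * Θ x) = ρ x * Θ (ρ x) := by
  rw [map_mul, hΘρ]

/-- `N_Θ(ρ x)·ρ(N_Θ(ρ x))⁻¹`-bookkeeping: **`t = ρN∕N` HAS NORM ONE**, `t·ρt = 1` (`ρρ = id`, `N ≠ 0`). [cite: Serre1979, Ch. V §3] -/
theorem map_div_self_mul_map (hρρ : ∀ x, ρ (ρ x) = x) {N : K} (hN : N ≠ 0) : ρ N / N * ρ (ρ N / N) = 1 := by
  rw [map_div₀, hρρ, div_mul_div_comm, mul_comm (ρ N) N, div_self (mul_ne_zero hN ((map_ne_zero ρ).2 hN))]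

/-- **`ρ y = −(ρh·ρN·c(α − ρα))`** for the dual generator `y = h·N·c(α − ρα)`, `N = x₀Θx₀`, `c` `ρ`-fixed (`ρρ = id`: `ρ(α − ρα) = −(α − ρα)`). [cite: Jacobowitz1962, §4] -/
theorem map_hermGen_eq (hρρ : ∀ x, ρ (ρ x) = x) {c : K} (hc : ρ c = c) (h x₀ : K) :
    ρ (h * (x₀ * Θ x₀) * (c * (α - ρ α))) = -(ρ h * ρ (x₀ * Θ x₀) * (c * (α - ρ α))) := by
  simp only [map_mul, map_sub, hρρ, hc]
  ring

/-- **`y − ρy = y·(1 + (ρh∕h)·(ρN∕N))`** (`h ≠ 0`, `x₀ ≠ 0`): the `ρ`-twist of the dual generator is governed by the product of the two norm-one elements `η = ρh∕h` and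
`t = ρN∕N` of the third field. [cite: Jacobowitz1962, §4] [cite: Serre1979, Ch. V §3] -/
theorem hermGen_sub_map_eq (hρρ : ∀ x, ρ (ρ x) = x) {c : K} (hc : ρ c = c) {h x₀ : K} (hh : h ≠ 0) (hx₀ : x₀ ≠ 0) (hΘx₀ : Θ x₀ ≠ 0) :
    h * (x₀ * Θ x₀) * (c * (α - ρ α)) - ρ (h * (x₀ * Θ x₀) * (c * (α - ρ α))) =
      h * (x₀ * Θ x₀) * (c * (α - ρ α)) * (1 + ρ h / h * (ρ (x₀ * Θ x₀) / (x₀ * Θ x₀))) := by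
  rw [map_hermGen_eq hρρ hc]
  have hN : x₀ * Θ x₀ ≠ 0 := mul_ne_zero hx₀ hΘx₀
  field_simp
  ring

/-- **`t` IS BLIND TO `ρ`-FIXED RESCALING**: `N_Θ(e·x₀) = N_Θ(e)·N_Θ(x₀)` and for `ρe = e` (`e ∈ E`, e.g. `e = ϖ_E^k`) `ρ(N_Θ e) = N_Θ e`, so `ρN′∕N′ = ρN∕N` (`e, x₀ ≠ 0`).
[cite: Jacobowitz1962, §4] -/
theorem map_div_mul_theta_self_of_fixed (hΘρ : ∀ x, Θ (ρ x) = ρ (Θ x)) {e : K} (he : ρ e = e) (he0 : e ≠ 0) (hΘe : Θ e ≠ 0) (x₀ : K) :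
    ρ (e * x₀ * Θ (e * x₀)) / (e * x₀ * Θ (e * x₀)) = ρ (x₀ * Θ x₀) / (x₀ * Θ x₀) := by
  have h1 : e * x₀ * Θ (e * x₀) = (e * Θ e) * (x₀ * Θ x₀) := by rw [map_mul]; ring
  have h2 : ρ (e * Θ e) = e * Θ e := by rw [map_mul, he, ← hΘρ, he]
  rw [h1, map_mul, h2, mul_div_mul_left _ _ (mul_ne_zero he0 hΘe)]

end Algebra

/-! ## §2 Valuations of the dual generator and of its `ρ`-twist -/

section Valued

variable [Valued K ℤᵐ⁰] {ρ Θ : K →+* K} {α : K}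

/-- **`|y| = |h|·|x₀|²·|c|·|α − ρα|`** (`Θ` isometric): the LEVEL of the lattice `x₀·𝒪_j` is `a = v(h) + 2v(x₀) + v(c) + v(α − ρα)`. [cite: Jacobowitz1962, §4] -/
theorem v_hermGen_eq (hvΘ : ∀ x, Valued.v (Θ x) = Valued.v x) (h x₀ c : K) :
    Valued.v (h * (x₀ * Θ x₀) * (c * (α - ρ α))) = Valued.v h * (Valued.v x₀ * Valued.v x₀) * (Valued.v c * Valued.v (α - ρ α)) := by
  simp only [map_mul, hvΘ]

/-- **`|y − ρy| = |y|·|1 + (ρh∕h)·(ρN∕N)|`** — the `ρ`-DEPTH of the dual generator is the valuation of `1 + η·t` on the norm-one torus of `K♮` (T5a (M3)).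
[cite: Serre1979, Ch. V §3] [cite: Jacobowitz1962, §4] -/
theorem v_hermGen_sub_map_eq (hρρ : ∀ x, ρ (ρ x) = x) {c : K} (hc : ρ c = c) {h x₀ : K} (hh : h ≠ 0) (hx₀ : x₀ ≠ 0) (hΘx₀ : Θ x₀ ≠ 0) :
    Valued.v (h * (x₀ * Θ x₀) * (c * (α - ρ α)) - ρ (h * (x₀ * Θ x₀) * (c * (α - ρ α)))) =
      Valued.v (h * (x₀ * Θ x₀) * (c * (α - ρ α))) * Valued.v (1 + ρ h / h * (ρ (x₀ * Θ x₀) / (x₀ * Θ x₀))) := by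
  rw [hermGen_sub_map_eq hρρ hc hh hx₀ hΘx₀, map_mul]

/-- In the frame where `α − ρα` is a UNIT (`M ∕ E` UNRAMIFIED: T5a), the order predicate of conductor `c` reads `|z| ≤ 1 ∧ |z − ρz| ≤ |c|`. [cite: Flicker1998UnitaryFL, p. 84] -/
theorem v_conductor_mul_eq_of_v_sub_map_eq_one (hδ : Valued.v (α - ρ α) = 1) (c : K) : Valued.v (c * (α - ρ α)) = Valued.v c := by
  rw [map_mul, hδ, mul_one]

/-! ## §3 The integral ∧ Gram-primitive dichotomy (`ϖ` a `ρ`-fixed uniformiser of the one field: the `M ∕ E`-unramified frame) -/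

/-- Discreteness of `ℤᵐ⁰`: **`x ≤ r` and `r < x·exp 1` force `x = r`**. [cite: Serre1979, Ch. V §3] -/
theorem eq_of_le_of_lt_mul_exp {x r : ℤᵐ⁰} (hxr : x ≤ r) (hrx : r < x * exp 1) : x = r := by
  have hx : x ≠ 0 := by rintro rfl; rw [zero_mul] at hrx; exact not_lt_bot hrx
  exact le_antisymm hxr ((lt_mul_exp_iff_le hx).1 hrx)

/-- Dividing by a `ρ`-FIXED uniformiser: `y∕ϖ − ρ(y∕ϖ) = (y − ρy)∕ϖ`, so **`|y∕ϖ − ρ(y∕ϖ)| = |y − ρy|·exp 1`** and `|y∕ϖ| = |y|·exp 1` (`|ϖ| = exp(−1)`, `ρϖ = ϖ`).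
[cite: Serre1979, Ch. V §3] -/
theorem v_div_sub_map_div_eq {ϖ : K} (hϖ : Valued.v ϖ = exp (-1 : ℤ)) (hρϖ : ρ ϖ = ϖ) (y : K) :
    Valued.v (y / ϖ - ρ (y / ϖ)) = Valued.v (y - ρ y) * exp (1 : ℤ) ∧ Valued.v (y / ϖ) = Valued.v y * exp (1 : ℤ) := by
  have hϖ0 : ϖ ≠ 0 := fun h0 => by rw [h0, map_zero] at hϖ; exact (exp_ne_zero hϖ.symm).elim
  have hinv : (Valued.v ϖ)⁻¹ = exp (1 : ℤ) := by rw [hϖ, ← exp_neg, neg_neg]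
  refine ⟨?_, ?_⟩
  · rw [map_div₀, hρϖ, ← sub_div, map_div₀, div_eq_mul_inv, hinv]
  · rw [map_div₀, div_eq_mul_inv, hinv]

/-- **THE INTEGRAL ∧ GRAM-PRIMITIVE DICHOTOMY** (T5a (M2), E1 (L2) «`a(ω) = j − c(ω)`, `a = 0` when `c ≥ j`»).  For `ϖ` a `ρ`-fixed uniformiser (`|ϖ| = exp(−1)`, `ρϖ = ϖ` —
the `M ∕ E`-UNRAMIFIED frame) and any bound `r ≠ 0` (the order bound `|c(α − ρα)|`): `y` satisfies the order predicate and `y∕ϖ` does NOT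
`⟺ (|y| = 1 ∧ |y − ρy| ≤ r) ∨ (|y| ≤ 1 ∧ |y − ρy| = r)` — an integral Gram-primitive dual generator is either a UNIT of `ρ`-depth at least the conductor, or a non-unit
integer whose `ρ`-twist `|y − ρy|` sits EXACTLY at the conductor bound. [cite: Jacobowitz1962, §4] [cite: Serre1979, Ch. V §3] -/
theorem order_and_not_order_div_iff {ϖ : K} (hϖ : Valued.v ϖ = exp (-1 : ℤ)) (hρϖ : ρ ϖ = ϖ) {r : ℤᵐ⁰} (hr : r ≠ 0) (y : K) :
    ((Valued.v y ≤ 1 ∧ Valued.v (y - ρ y) ≤ r) ∧ ¬ (Valued.v (y / ϖ) ≤ 1 ∧ Valued.v (y / ϖ - ρ (y / ϖ)) ≤ r)) ↔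
      (Valued.v y = 1 ∧ Valued.v (y - ρ y) ≤ r) ∨ (Valued.v y ≤ 1 ∧ Valued.v (y - ρ y) = r) := by
  obtain ⟨h1, h2⟩ := v_div_sub_map_div_eq (ρ := ρ) hϖ hρϖ y
  rw [h1, h2]
  constructor
  · rintro ⟨⟨hy1, hyr⟩, hnot⟩
    rw [not_and_or, not_le, not_le] at hnot
    rcases hnot with hlt | hlt
    · -- `1 < |y|·exp 1` with `|y| ≤ 1`: `|y| = 1`
      exact Or.inl ⟨eq_of_le_of_lt_mul_exp hy1 hlt, hyr⟩
    · -- `r < |y − ρy|·exp 1` with `|y − ρy| ≤ r`: equality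
      exact Or.inr ⟨hy1, eq_of_le_of_lt_mul_exp hyr hlt⟩
  · rintro (⟨hy1, hyr⟩ | ⟨hy1, hyr⟩)
    · refine ⟨⟨hy1.le, hyr⟩, fun hc => ?_⟩
      have := hc.1
      rw [hy1, one_mul, ← not_lt] at this
      exact this (by rw [← exp_zero, exp_lt_exp]; norm_num)
    · refine ⟨⟨hy1, hyr.le⟩, fun hc => ?_⟩
      have := hc.2
      rw [hyr, ← not_lt] at this
      exact this ((lt_mul_exp_iff_le hr).2 le_rfl)

/-- The dichotomy for the DUAL GENERATOR `y = h·x₀Θ(x₀)·c(α − ρα)` of `x₀·𝒪_j` in ★ T4's letters, in the `M ∕ E`-UNRAMIFIED frame (`|α − ρα| = 1`, `ϖ` a `ρ`-fixed uniformiser,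
conductor `c ≠ 0`): `y` lies in the order of conductor `c` and `y∕ϖ` does not (INTEGRAL and GRAM-PRIMITIVE, by ★ T4c `forall_mem_forall_mem_v_herm_le_one_iff` ∕
`forall_mem_exists_dual_eq_mul_iff` at `e = ϖ`) **iff `(|y| = 1 ∧ |y − ρy| ≤ |c|) ∨ (|y| ≤ 1 ∧ |y − ρy| = |c|)`** — with §2 `|y − ρy| = |y|·|1 + ηt|`: level `a = v(y) ≥ 1`
forces `v(1 + ηt) = j − a` EXACTLY, level `0` forces `v(1 + ηt) ≥ j` (`|c| = exp(−j)`). [cite: Jacobowitz1962, §4] [cite: Flicker1998UnitaryFL, p. 84] -/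
theorem hermGen_order_and_not_order_div_iff (hδ : Valued.v (α - ρ α) = 1) {ϖ : K} (hϖ : Valued.v ϖ = exp (-1 : ℤ)) (hρϖ : ρ ϖ = ϖ)
    {c : K} (hc0 : c ≠ 0) (h x₀ : K) :
    ((Valued.v (h * (x₀ * Θ x₀) * (c * (α - ρ α))) ≤ 1 ∧
        Valued.v (h * (x₀ * Θ x₀) * (c * (α - ρ α)) - ρ (h * (x₀ * Θ x₀) * (c * (α - ρ α)))) ≤ Valued.v (c * (α - ρ α))) ∧
      ¬ (Valued.v (h * (x₀ * Θ x₀) * (c * (α - ρ α)) / ϖ) ≤ 1 ∧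
        Valued.v (h * (x₀ * Θ x₀) * (c * (α - ρ α)) / ϖ - ρ (h * (x₀ * Θ x₀) * (c * (α - ρ α)) / ϖ)) ≤ Valued.v (c * (α - ρ α)))) ↔
      (Valued.v (h * (x₀ * Θ x₀) * (c * (α - ρ α))) = 1 ∧
          Valued.v (h * (x₀ * Θ x₀) * (c * (α - ρ α)) - ρ (h * (x₀ * Θ x₀) * (c * (α - ρ α)))) ≤ Valued.v c) ∨
        (Valued.v (h * (x₀ * Θ x₀) * (c * (α - ρ α))) ≤ 1 ∧
          Valued.v (h * (x₀ * Θ x₀) * (c * (α - ρ α)) - ρ (h * (x₀ * Θ x₀) * (c * (α - ρ α)))) = Valued.v c) := by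
  rw [v_conductor_mul_eq_of_v_sub_map_eq_one hδ]
  exact order_and_not_order_div_iff hϖ hρϖ ((Valuation.ne_zero_iff _).2 hc0) _

/-! ## §4 The DEPTH CONDITION `(λ − u)∕y ∈ 𝒪_j`: the `ρ`-twist of `z = (λ − u)∕y` is `|z|·|(1 + θ) + (κ − 1)|`, `θ = (ρh∕h)(ρN∕N)`, `κ = ρ(λ − u)∕(λ − u)`
(E1 v1 (C) «`c(w) = min(ℓ, c)`», `ℓ = v(λ − ρλ) − v(λ − u)`, off the diagonal `ℓ ≠ c`) -/

omit [Valued K ℤᵐ⁰] in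
/-- **`ρ y = −θ·y`** with `θ := (ρh∕h)·(ρN∕N)`, `N = x₀Θx₀` (`h, x₀ ≠ 0`): the dual generator is a `(−θ)`-EIGENVECTOR of `ρ`. [cite: Jacobowitz1962, §4] -/
theorem map_hermGen_eq_neg_mul (hρρ : ∀ x, ρ (ρ x) = x) {c : K} (hc : ρ c = c) {h x₀ : K} (hh : h ≠ 0) (hx₀ : x₀ ≠ 0) (hΘx₀ : Θ x₀ ≠ 0) :
    ρ (h * (x₀ * Θ x₀) * (c * (α - ρ α))) = -(ρ h / h * (ρ (x₀ * Θ x₀) / (x₀ * Θ x₀)) * (h * (x₀ * Θ x₀) * (c * (α - ρ α)))) := by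
  rw [map_hermGen_eq hρρ hc]
  have hN : x₀ * Θ x₀ ≠ 0 := mul_ne_zero hx₀ hΘx₀
  field_simp

omit [Valued K ℤᵐ⁰] in
/-- The `ρ`-TWIST OF A QUOTIENT `z = w∕y` by a `(−θ)`-eigenvector `y` (`ρy = −θy`, `θ, y, w ≠ 0`): **`z − ρz = z·(θ + ρw∕w)∕θ`**, so `|z − ρz| = |z|·|θ + κ|∕|θ|` with
`κ = ρw∕w`. [cite: Jacobowitz1962, §4] -/
theorem div_sub_map_div_eq {θ y w : K} (hρy : ρ y = -(θ * y)) (hθ : θ ≠ 0) (hy : y ≠ 0) (hw : w ≠ 0) :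
    w / y - ρ (w / y) = w / y * ((θ + ρ w / w) / θ) := by
  rw [map_div₀, hρy]
  field_simp
  ring

/-- **THE `ρ`-DEPTH OF `z = (λ − u)∕y`** (`u` `ρ`-FIXED — `u ∈ E`; `|θ| = 1`): `|z − ρz| = |z|·|(1 + θ) + (κ − 1)|` where `|1 + θ| = |y − ρy|∕|y|` (§2) is the `ρ`-depth of the lattice
and **`|κ − 1| = |λ − ρλ|∕|λ − u|`** (`κ = ρ(λ − u)∕(λ − u)`; `v(λ − ρλ) = j_λ` is the conductor level of `λ`, `v(λ − u) = m` the depth token).  [cite: Jacobowitz1962, §4]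
[cite: Flicker1998UnitaryFL, p. 84] -/
theorem v_depthQuot_sub_map_eq {θ y lam u : K} (hρy : ρ y = -(θ * y)) (hθ : Valued.v θ = 1) (hy : y ≠ 0)
    (hu : ρ u = u) (hlu : lam ≠ u) :
    Valued.v ((lam - u) / y - ρ ((lam - u) / y)) = Valued.v ((lam - u) / y) * Valued.v ((1 + θ) + (ρ (lam - u) / (lam - u) - 1)) ∧
      Valued.v (ρ (lam - u) / (lam - u) - 1) = Valued.v (lam - ρ lam) / Valued.v (lam - u) := by
  have hθ0 : θ ≠ 0 := fun h0 => by rw [h0, map_zero] at hθ; exact zero_ne_one hθ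
  have hw : lam - u ≠ 0 := sub_ne_zero.2 hlu
  refine ⟨?_, ?_⟩
  · rw [div_sub_map_div_eq hρy hθ0 hy hw, map_mul]
    congr 1
    rw [map_div₀, hθ, div_one]
    congr 1
    ring
  · rw [div_sub_one hw, map_div₀, map_sub ρ lam u, hu, show ρ lam - u - (lam - u) = -(lam - ρ lam) by ring, Valuation.map_neg]

/-- **OFF THE DIAGONAL THE `ρ`-DEPTH OF `(λ − u)∕y` IS THE MINIMUM** (E1 v1 (C)): if the lattice depth `|1 + θ| = |y − ρy|∕|y|` and the element depth `|λ − ρλ|∕|λ − u|` DIFFER, then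
`|z − ρz| = |z|·max(|1 + θ|, |λ − ρλ|∕|λ − u|)` — so the depth condition `z ∈ 𝒪_j` (`|z| ≤ 1 ∧ |z − ρz| ≤ |ϖ|^j`) is decided by the tokens `(m, a, j, c, ℓ)` alone (LOW ∕ DEAD
cells); only the diagonal `c = ℓ` needs a finer digit (TOP cells). [cite: Jacobowitz1962, §4] [cite: Serre1979, Ch. V §3] -/
theorem v_depthQuot_sub_map_eq_max {θ y lam u : K} (hρy : ρ y = -(θ * y)) (hθ : Valued.v θ = 1) (hy : y ≠ 0)
    (hu : ρ u = u) (hlu : lam ≠ u) (hne : Valued.v (1 + θ) ≠ Valued.v (lam - ρ lam) / Valued.v (lam - u)) :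
    Valued.v ((lam - u) / y - ρ ((lam - u) / y)) =
      Valued.v ((lam - u) / y) * max (Valued.v (1 + θ)) (Valued.v (lam - ρ lam) / Valued.v (lam - u)) := by
  obtain ⟨h1, h2⟩ := v_depthQuot_sub_map_eq hρy hθ hy hu hlu
  rw [h1, ← h2, Valuation.map_add_of_distinct_val _ (by rwa [h2])]

end Valued

end Literature.NumberTheory.LocalFields.QuadraticOrder
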